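import Summits.FinalStateConjecture.FinalStateConjecture.Theorems.EIHFluxBalanceInertialRecessionStubEndgameOraclePairMain
import Summits.FinalStateConjecture.FinalStateConjecture.Theorems.EIHFluxBalanceInertialRecessionStubEndgameOracleUnivBandsMain

/-!
# Route EIHFluxBalance — crux `InertialRecession`, line `sublinear-is-free-clean-window-charges`:
# the increment oracle, ASSEMBLY I — the case analysis `|S| ≤ 2 ∨ S = univ` on a late interval

Helper file for the crux `stmt-FinalStateConjecture-10166`
(`Summit.FinalStateConjecture.FinalStateConjecture.Theses.EIHFluxBalance.InertialRecession`), registered stub `stub_incrementOracle`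
(lead reshape r9/r10) of `Cruxes/InertialRecession/Lines/sublinear_is_free_clean_window_charges.lean`.

`oracle_cases`: on a late interval `[t₁,t₂]` (instances of the window law and identification in force, speeds `≤ 1`, cone, all distances
`≥ A₀`, two-point `σ`-slowness inside `S`, ballistic outsiders with floor `W/2`, threshold `ρ` below `‖ξᵢ − ξⱼ‖/3` and below
`(4/3)λ_min c₀ s`), a nonempty member set with `|S| ≤ 2 ∨ S = univ` changes its energy and momentum components by at most
`B₁ + B₂ + B₃` — the bounds of `tight_increment` (`|S| = 1`), `pair_slow_increment` (`|S| = 2`) and `univ_slow_increment` (`S = univ`),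
with `|Sᶜ| ≤ N`. For `N ≤ 3` every member set is of this kind.
-/

noncomputable section

set_option linter.dupNamespace false

open Filter Topology Set MeasureTheory intervalIntegral
open scoped Topology BigOperators InnerProductSpace RealInnerProductSpace

namespace Summit.FinalStateConjecture.FinalStateConjecture.Theorems.SublinearIsFree.Oracle

open Literature.Geometry.Lorentzian
open Summit.FinalStateConjecture.FinalStateConjecture.Theorems.SublinearIsFree.Endgame

set_option maxHeartbeats 3200000 in
/-- **THE INCREMENT ORACLE ON A LATE INTERVAL, CASES `|S| ≤ 2 ∨ S = univ`.** See the module docstring. [folklore] -/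
theorem oracle_cases {N : ℕ} (M : Fin N → ℝ) (ξ v : Fin N → ℝ → E3) (κ : ℝ) (P : ℝ → E3 → ℝ → Fin 4 → ℝ)
    (ρ : ℝ → ℝ) (C T T' T₀ : ℝ) (ζ : ℝ → ℝ)
    (hWL : ∀ (t₁ t₂ : ℝ) (c : ℝ → E3) (R : ℝ → ℝ), T ≤ t₁ → t₁ ≤ t₂ →
      (∀ s ∈ Set.Icc t₁ t₂, ∀ s' ∈ Set.Icc t₁ t₂, ‖c s - c s'‖ ≤ 2 * |s - s'| ∧ |R s - R s'| ≤ 2 * |s - s'|) →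
      (∀ s ∈ Set.Icc t₁ t₂, ρ s ≤ (1 / 2) * R s ∧ ‖c s‖ + R s ≤ (κ + κ ^ 2) / 2 * s ∧
        ∀ j, ‖ξ j s - c s‖ ≤ (1 - 1 / 2) * R s ∨ (1 + 1 / 2) * R s ≤ ‖ξ j s - c s‖) →
      ∀ μ : Fin 4, |P t₂ (c t₂) (R t₂) μ - P t₁ (c t₁) (R t₁) μ| ≤ C * ∫ s in t₁..t₂, (R s ^ (3 / 2 : ℝ))⁻¹)
    (hID : ∀ (t : ℝ) (c : E3) (R : ℝ) (A : Finset (Fin N)), T' ≤ t → ρ t ≤ (1 / 2) * R →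
      ‖c‖ + R ≤ (κ + κ ^ 2) / 2 * t →
      (∀ j, ‖ξ j t - c‖ ≤ (1 - 1 / 2) * R ∨ (1 + 1 / 2) * R ≤ ‖ξ j t - c‖) →
      (∀ j, j ∈ A ↔ ‖ξ j t - c‖ ≤ (1 - 1 / 2) * R) →
      |P t c R 0 - ∑ j ∈ A, M j * (√(1 - ‖v j t‖ ^ 2))⁻¹| ≤ ζ t ∧
      ∀ k : Fin 3, |P t c R k.succ - ∑ j ∈ A, M j * (√(1 - ‖v j t‖ ^ 2))⁻¹ * v j t k| ≤ ζ t)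
    (hC : 0 ≤ C) (hκ0 : 0 < κ) (hκ1 : κ < 1)
    (hξ : ∀ i, ContDiff ℝ 1 (ξ i)) (hspeed1 : ∀ i s, T₀ ≤ s → ‖deriv (ξ i) s‖ ≤ 1)
    {S : Finset (Fin N)} (hS : S.Nonempty) (hcase : S.card ≤ 2 ∨ S = Finset.univ)
    {t₁ t₂ W A₀ σ ζstar : ℝ} (hT : T ≤ t₁) (hT' : T' ≤ t₁) (hT₀ : T₀ ≤ t₁) (ht₁ : 0 < t₁) (h12 : t₁ ≤ t₂)
    (hW : 0 < W) (hA₀ : 0 < A₀) (hσ0 : 0 ≤ σ) (hσ1 : 78 * σ ≤ W) (hσ2 : 120 * N * σ ≤ W)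
    (hσ3 : σ ≤ (κ - κ ^ 2) / 2 * (2⁻¹ / 16 ^ (N * N + 1)))
    (hcone : ∀ i, ∀ s ∈ Set.Icc t₁ t₂, ‖ξ i s‖ ≤ κ ^ 2 * s)
    (n : Fin N → Fin N → E3) (hn : ∀ i ∈ S, ∀ m ∈ Finset.univ \ S, ‖n i m‖ = 1)
    (hball : ∀ i ∈ S, ∀ m ∈ Finset.univ \ S, ∀ s ∈ Icc t₁ t₂, W / 2 ≤ ⟪deriv (ξ m) s - deriv (ξ i) s, n i m⟫)
    (hfar : ∀ i j, i ≠ j → ∀ s ∈ Icc t₁ t₂, A₀ ≤ ‖ξ i s - ξ j s‖)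
    (hslow : ∀ k ∈ S, ∀ l ∈ S, ∀ s ∈ Icc t₁ t₂, ∀ s' ∈ Icc t₁ t₂, s ≤ s' →
      |‖ξ k s' - ξ l s'‖ - ‖ξ k s - ξ l s‖| ≤ σ * (s' - s))
    (hρ : ∀ s ∈ Set.Icc t₁ t₂, (∀ i j, i ≠ j → ρ s ≤ ‖ξ i s - ξ j s‖ / 3) ∧
      ρ s ≤ 4 / 3 * (2⁻¹ / 16 ^ (N * N + 1)) * ((κ - κ ^ 2) / 2) * s)
    (hζ : ∀ s ∈ Set.Icc t₁ t₂, ζ s ≤ ζstar) (hζ0 : ∀ s ∈ Set.Icc t₁ t₂, 0 ≤ ζ s) :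
    |∑ j ∈ S, M j * (√(1 - ‖v j t₂‖ ^ 2))⁻¹ - ∑ j ∈ S, M j * (√(1 - ‖v j t₁‖ ^ 2))⁻¹| ≤
        (C * (2 * (((κ - κ ^ 2) / 2) ^ (3 / 2 : ℝ))⁻¹ * (t₁ ^ (1 / 2 : ℝ))⁻¹ + N * (2 * (2 * √2 * (8 / (W * √A₀))))) + 2 * ζstar) +
        (2 * (C * (2 * (((κ - κ ^ 2) / 2) ^ (3 / 2 : ℝ))⁻¹ * (t₁ ^ (1 / 2 : ℝ))⁻¹ + N * (2 * (2 * √2 * (8 / (W * √A₀)))) +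
          1 * (2 * (2 * (((κ - κ ^ 2) / 2 / 4) ^ (3 / 2 : ℝ))⁻¹ * (t₁ ^ (1 / 2 : ℝ))⁻¹))) + 2 * ζstar) +
        (N + 1) * (3 * (C * (2 * (((κ - κ ^ 2) / 2) ^ (3 / 2 : ℝ))⁻¹ * (t₁ ^ (1 / 2 : ℝ))⁻¹ + N * (2 * (2 * √2 * (8 / (W * √A₀)))) +
          2 * (19 * N / (W * √A₀))) + 2 * ζstar))) +
        (N * N * (N * N + 2) + 1) * (N * (C * (2 * (((κ - κ ^ 2) / 2) ^ (3 / 2 : ℝ))⁻¹ * (t₁ ^ (1 / 2 : ℝ))⁻¹ +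
          N * (2 * (2 * ((4 * (2⁻¹ / 16 ^ (N * N + 1)) * ((κ - κ ^ 2) / 2)) ^ (3 / 2 : ℝ))⁻¹ * (t₁ ^ (1 / 2 : ℝ))⁻¹))) +
          2 * ζstar)) ∧
    ∀ kk : Fin 3, |∑ j ∈ S, M j * (√(1 - ‖v j t₂‖ ^ 2))⁻¹ * v j t₂ kk - ∑ j ∈ S, M j * (√(1 - ‖v j t₁‖ ^ 2))⁻¹ * v j t₁ kk| ≤
        (C * (2 * (((κ - κ ^ 2) / 2) ^ (3 / 2 : ℝ))⁻¹ * (t₁ ^ (1 / 2 : ℝ))⁻¹ + N * (2 * (2 * √2 * (8 / (W * √A₀))))) + 2 * ζstar) +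
        (2 * (C * (2 * (((κ - κ ^ 2) / 2) ^ (3 / 2 : ℝ))⁻¹ * (t₁ ^ (1 / 2 : ℝ))⁻¹ + N * (2 * (2 * √2 * (8 / (W * √A₀)))) +
          1 * (2 * (2 * (((κ - κ ^ 2) / 2 / 4) ^ (3 / 2 : ℝ))⁻¹ * (t₁ ^ (1 / 2 : ℝ))⁻¹))) + 2 * ζstar) +
        (N + 1) * (3 * (C * (2 * (((κ - κ ^ 2) / 2) ^ (3 / 2 : ℝ))⁻¹ * (t₁ ^ (1 / 2 : ℝ))⁻¹ + N * (2 * (2 * √2 * (8 / (W * √A₀)))) +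
          2 * (19 * N / (W * √A₀))) + 2 * ζstar))) +
        (N * N * (N * N + 2) + 1) * (N * (C * (2 * (((κ - κ ^ 2) / 2) ^ (3 / 2 : ℝ))⁻¹ * (t₁ ^ (1 / 2 : ℝ))⁻¹ +
          N * (2 * (2 * ((4 * (2⁻¹ / 16 ^ (N * N + 1)) * ((κ - κ ^ 2) / 2)) ^ (3 / 2 : ℝ))⁻¹ * (t₁ ^ (1 / 2 : ℝ))⁻¹))) +
          2 * ζstar)) := by
  classical
  set c₀ : ℝ := (κ - κ ^ 2) / 2 with hc₀def
  have hκκ : 0 < κ - κ ^ 2 := by nlinarith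
  have hc₀ : 0 < c₀ := by positivity
  set lmin : ℝ := 2⁻¹ / 16 ^ (N * N + 1) with hlmin
  have hlmin_pos : 0 < lmin := by positivity
  have hlmin_le : lmin ≤ 1 / 32 := by
    rw [hlmin]
    have : (16 : ℝ) ≤ 16 ^ (N * N + 1) := by
      calc (16 : ℝ) = 16 ^ 1 := (pow_one _).symm
        _ ≤ 16 ^ (N * N + 1) := pow_le_pow_right₀ (by norm_num) (by omega)
    rw [div_le_iff₀ (by positivity)]; nlinarith
  have hζstar0 : 0 ≤ ζstar := (hζ0 t₁ ⟨le_rfl, h12⟩).trans (hζ t₁ ⟨le_rfl, h12⟩)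
  -- the three bounds
  set B₁ : ℝ := C * (2 * (c₀ ^ (3 / 2 : ℝ))⁻¹ * (t₁ ^ (1 / 2 : ℝ))⁻¹ + N * (2 * (2 * √2 * (8 / (W * √A₀))))) + 2 * ζstar with hB₁
  set B₂ : ℝ := 2 * (C * (2 * (c₀ ^ (3 / 2 : ℝ))⁻¹ * (t₁ ^ (1 / 2 : ℝ))⁻¹ + N * (2 * (2 * √2 * (8 / (W * √A₀)))) +
      1 * (2 * (2 * ((c₀ / 4) ^ (3 / 2 : ℝ))⁻¹ * (t₁ ^ (1 / 2 : ℝ))⁻¹))) + 2 * ζstar) +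
      (N + 1) * (3 * (C * (2 * (c₀ ^ (3 / 2 : ℝ))⁻¹ * (t₁ ^ (1 / 2 : ℝ))⁻¹ + N * (2 * (2 * √2 * (8 / (W * √A₀)))) +
      2 * (19 * N / (W * √A₀))) + 2 * ζstar)) with hB₂
  set B₃ : ℝ := (N * N * (N * N + 2) + 1) * (N * (C * (2 * (c₀ ^ (3 / 2 : ℝ))⁻¹ * (t₁ ^ (1 / 2 : ℝ))⁻¹ +
      N * (2 * (2 * ((4 * lmin * c₀) ^ (3 / 2 : ℝ))⁻¹ * (t₁ ^ (1 / 2 : ℝ))⁻¹))) + 2 * ζstar)) with hB₃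
  have hB₁0 : 0 ≤ B₁ := by positivity
  have hB₂0 : 0 ≤ B₂ := by positivity
  have hB₃0 : 0 ≤ B₃ := by positivity
  -- common: `ρ ≤ c₀ s / 2`
  have hρc : ∀ s ∈ Set.Icc t₁ t₂, ρ s ≤ c₀ * s / 2 := by
    intro s hs
    have h := (hρ s hs).2
    have hs0 : 0 ≤ c₀ * s := mul_nonneg hc₀.le (ht₁.le.trans hs.1)
    have : 4 / 3 * lmin ≤ 1 / 2 := by linarith
    nlinarith
  -- reduce the goal to a per-case bound
  suffices hmain : (|∑ j ∈ S, M j * (√(1 - ‖v j t₂‖ ^ 2))⁻¹ - ∑ j ∈ S, M j * (√(1 - ‖v j t₁‖ ^ 2))⁻¹| ≤ B₁ + B₂ + B₃) ∧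
      ∀ kk : Fin 3, |∑ j ∈ S, M j * (√(1 - ‖v j t₂‖ ^ 2))⁻¹ * v j t₂ kk - ∑ j ∈ S, M j * (√(1 - ‖v j t₁‖ ^ 2))⁻¹ * v j t₁ kk| ≤
        B₁ + B₂ + B₃ by
    simpa only [hB₁, hB₂, hB₃, hc₀def, hlmin] using hmain
  ---------------------------------------------------------------- case `S = univ`
  by_cases huniv : S = Finset.univ
  · subst huniv
    have h := univ_slow_increment M ξ v κ P ρ C T T' T₀ ζ hWL hID hC hκ0 hκ1 hξ hspeed1 hT hT' hT₀ ht₁ h12 hcone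
      (fun k l s hs s' hs' hss' ↦ hslow k (Finset.mem_univ k) l (Finset.mem_univ l) s hs s' hs' hss') hσ3
      (fun s hs ↦ (hρ s hs).2) hζ
    refine ⟨?_, fun kk ↦ ?_⟩
    · have := h.1; simp only [← hc₀def, ← hlmin] at this ⊢; linarith
    · have := h.2 kk; simp only [← hc₀def, ← hlmin] at this ⊢; linarith
  -- `S ≠ univ`: the complement is nonempty and `|S| ≤ 2`
  have hSc : (Finset.univ \ S).Nonempty := by
    rw [Finset.sdiff_nonempty]; intro hsub
    exact huniv (Finset.eq_univ_of_forall fun x ↦ hsub (Finset.mem_univ x))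
  have hcard : S.card ≤ 2 := hcase.resolve_right huniv
  have hcardc : ((Finset.univ \ S).card : ℝ) ≤ N := by
    have := Finset.card_le_univ (Finset.univ \ S); rw [Fintype.card_fin] at this; exact_mod_cast this
  rcases Nat.lt_or_ge S.card 2 with hlt | hge
  · ---------------------------------------------------------------- case `|S| = 1`
    have hc1 : S.card = 1 := by have := Finset.card_pos.mpr hS; omega
    obtain ⟨a, rfl⟩ := Finset.card_eq_one.mp hc1
    have ha : a ∈ ({a} : Finset (Fin N)) := Finset.mem_singleton_self a
    have hρ' : ∀ s ∈ Set.Icc t₁ t₂,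
        ρ s ≤ min ((κ - κ ^ 2) / 2 * s) (2 / 3 * (Finset.univ \ {a}).inf' hSc fun j ↦ ‖ξ j s - ξ a s‖) / 2 := by
      intro s hs
      have h1 := hρc s hs
      have h2 : 3 * ρ s ≤ (Finset.univ \ {a}).inf' hSc fun j ↦ ‖ξ j s - ξ a s‖ :=
        Finset.le_inf' _ _ fun j hj ↦ by
          have hja : j ≠ a := by simpa using hj
          have := (hρ s hs).1 j a hja; linarith
      rw [← hc₀def, le_div_iff₀ (by norm_num : (0 : ℝ) < 2), le_min_iff]
      constructor <;> linarith
    have htight : ∀ s ∈ Set.Icc t₁ t₂, ∀ i ∈ ({a} : Finset (Fin N)),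
        ‖ξ i s - ξ a s‖ ≤ min ((κ - κ ^ 2) / 2 * s) (2 / 3 * (Finset.univ \ {a}).inf' hSc fun j ↦ ‖ξ j s - ξ a s‖) / 2 := by
      intro s hs i hi
      have : i = a := by simpa using hi
      subst this
      simp only [sub_self, norm_zero]
      have hpos : 0 ≤ (Finset.univ \ {i}).inf' hSc fun j ↦ ‖ξ j s - ξ i s‖ := Finset.le_inf' _ _ fun j _ ↦ norm_nonneg _
      have hcs : 0 ≤ (κ - κ ^ 2) / 2 * s := by rw [← hc₀def]; exact mul_nonneg hc₀.le (ht₁.le.trans hs.1)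
      rw [le_div_iff₀ (by norm_num : (0 : ℝ) < 2), le_min_iff]
      constructor <;> linarith
    have h := tight_increment M ξ v κ P ρ C T T' T₀ ζ hWL hID hC hκ0 hκ1 hξ hspeed1 (S := {a}) (a := a) hSc
      hT hT' hT₀ ht₁ h12 hW hA₀ (hcone a) (n a) (fun j hj ↦ hn a ha j hj) (fun j hj s hs ↦ hball a ha j hj s hs)
      (fun j hj s hs ↦ by
        have hja : j ≠ a := by simpa using hj
        have := hfar a j hja.symm s hs; rwa [norm_sub_rev] at this)
      hρ' htight
    have hb : C * (2 * (((κ - κ ^ 2) / 2) ^ (3 / 2 : ℝ))⁻¹ * (t₁ ^ (1 / 2 : ℝ))⁻¹ +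
        (Finset.univ \ {a}).card * (2 * (2 * √2 * (8 / (W * √A₀))))) + ζ t₁ + ζ t₂ ≤ B₁ := by
      rw [hB₁, ← hc₀def]
      have h1 : ((Finset.univ \ {a}).card : ℝ) * (2 * (2 * √2 * (8 / (W * √A₀)))) ≤ N * (2 * (2 * √2 * (8 / (W * √A₀)))) :=
        mul_le_mul_of_nonneg_right hcardc (by positivity)
      have h2 := mul_le_mul_of_nonneg_left (add_le_add_left h1 (2 * (c₀ ^ (3 / 2 : ℝ))⁻¹ * (t₁ ^ (1 / 2 : ℝ))⁻¹)) hC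
      linarith [hζ t₁ ⟨le_rfl, h12⟩, hζ t₂ ⟨h12, le_rfl⟩]
    simp only [Finset.sum_singleton] at h ⊢
    exact ⟨(h.1.trans hb).trans (by linarith), fun kk ↦ ((h.2 kk).trans hb).trans (by linarith)⟩
  · ---------------------------------------------------------------- case `|S| = 2`
    have hc2 : S.card = 2 := le_antisymm hcard hge
    obtain ⟨k, l, hkl, rfl⟩ := Finset.card_eq_two.mp hc2
    have hkm : k ∈ ({k, l} : Finset (Fin N)) := by simp
    have hlm : l ∈ ({k, l} : Finset (Fin N)) := by simp
    have hσ2' : 120 * ((Finset.univ \ {k, l} : Finset (Fin N)).card : ℝ) * σ ≤ W := by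
      have : 120 * ((Finset.univ \ {k, l} : Finset (Fin N)).card : ℝ) * σ ≤ 120 * N * σ := by
        have := hcardc; nlinarith
      linarith
    have hσ3' : σ ≤ (κ - κ ^ 2) / 2 * (1 / 2) := by
      show σ ≤ c₀ * (1 / 2)
      have : c₀ * lmin ≤ c₀ * (1 / 2) := mul_le_mul_of_nonneg_left (by linarith) hc₀.le
      exact hσ3.trans this
    have h := pair_slow_increment M ξ v κ P ρ C T T' T₀ ζ hWL hID hC hκ0 hκ1 hξ hspeed1 hkl hT hT' hT₀ ht₁ h12 hW hA₀
      hσ0 hσ1 hσ2' hσ3' hcone n hn hball hfar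
      (fun s hs s' hs' hss' ↦ hslow l hlm k hkm s hs s' hs' hss')
      (fun s hs ↦ ⟨(hρ s hs).1, by have := hρc s hs; rw [← hc₀def]; linarith⟩) hζ hζ0
    -- monotonicity in the number of outsiders
    have hmono : 2 * (C * (2 * (((κ - κ ^ 2) / 2) ^ (3 / 2 : ℝ))⁻¹ * (t₁ ^ (1 / 2 : ℝ))⁻¹ +
          (Finset.univ \ {k, l} : Finset (Fin N)).card * (2 * (2 * √2 * (8 / (W * √A₀)))) +
          1 * (2 * (2 * (((κ - κ ^ 2) / 2 / 4) ^ (3 / 2 : ℝ))⁻¹ * (t₁ ^ (1 / 2 : ℝ))⁻¹))) + 2 * ζstar) +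
        ((Finset.univ \ {k, l} : Finset (Fin N)).card + 1) *
          (3 * (C * (2 * (((κ - κ ^ 2) / 2) ^ (3 / 2 : ℝ))⁻¹ * (t₁ ^ (1 / 2 : ℝ))⁻¹ +
            (Finset.univ \ {k, l} : Finset (Fin N)).card * (2 * (2 * √2 * (8 / (W * √A₀)))) +
            2 * (19 * (Finset.univ \ {k, l} : Finset (Fin N)).card / (W * √A₀))) + 2 * ζstar)) ≤ B₂ := by
      rw [hB₂, ← hc₀def]
      have hq0 : (0 : ℝ) ≤ (Finset.univ \ {k, l} : Finset (Fin N)).card := Nat.cast_nonneg _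
      have hc4 : c₀ / 4 = (κ - κ ^ 2) / 2 / 4 := by rw [hc₀def]
      rw [← hc4]
      gcongr
    refine ⟨(h.1.trans hmono).trans (by linarith), fun kk ↦ ((h.2 kk).trans hmono).trans (by linarith)⟩

/-- Registered helper form: the smallest band level is positive (carrier of this file). [folklore] -/
theorem oracle_lmin_pos : ∀ (N : ℕ), (0 : ℝ) < 2⁻¹ / 16 ^ (N * N + 1) := by
  intro N; positivity

end Summit.FinalStateConjecture.FinalStateConjecture.Theorems.SublinearIsFree.Oracle

end
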